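import Summits.BirchSwinnertonDyer.BirchSwinnertonDyer.Theorems.ByReductionTypeAtTwoSupersingularUnitAnchorKitMT
import Summits.BirchSwinnertonDyer.BirchSwinnertonDyer.Theorems.ByReductionTypeAtTwoSupersingularTwoCongruenceMuTransport
import Summits.BirchSwinnertonDyer.BirchSwinnertonDyer.Theorems.ThetaPartnerAtTwoTwoTorsionCongruence
import HarnessLib

/-!
# Crux `SupersingularRankZeroAtTwo` (item stmt-BirchSwinnertonDyer-19097): the UNIT-ANCHOR kit doors, `Λ`-form, MAZUR–TATE KEYED, with the
# `μ`-TRANSPORT AT THE PAIR IN THE KERNEL on the `Δ_E < 0` classes (seat `bsd-2adic-ss-1x` GEN 6; twins of GEN 5's `…UnitAnchorKitMT`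
# p577225 fed the CM-free transport `…TwoCongruenceMuTransport`)

HONEST FRAMING (cell `bsd-2adic`; HUMAN RULINGS D-0036/D-0054/D-0074): THEOREMS ONLY — no definition, no named fact, no instance, no `sorry`;
nothing about any curve is asserted beyond the displayed binders; closes nothing by itself; BSD is NOT proved by any of this. PARTITION
(D-0054): X5@2 good-ss `a₂ = 0` UNIT-ANCHOR sub-row (17 classes; the 12 with `Δ_E < 0`) × `p = 2` — types-the-object-of; bears_on: K4 19097.
The research content that remains displayed: (2′) at `E` and at the anchor (`hEC`, `hECA`), (4)ʳᵃᵗ at `E` (`hCK`), the `λ`-transport at the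
pair (`hlamT`, numeral `ℓ*`); GONE: the `μ`-transport binder (now `SignedTransportAtTwo.TwoCongruence.muTransport_two_of_twoCongruence_negDisc`,
a tree theorem for any two `a₂ = 0` good-ss curves with `E[2] ≅ A[2]` and `Δ_E < 0` — no CM, no analytic-rank hypothesis).

References: [BDKim2009] Cor. 2.13; [GreenbergVatsal2000] Thm. (1.4); [Kobayashi2003] Thm. 1.2, 4.1; [Kato2004Asterisque] Thm. 12.4–12.5 (3);
[BDKim2013] Cor. 3.15; [Pollack2003] Prop. 6.18; [PollackWeston2011MT] §3.1; [AbbesUllmo1996] Thm. A; [SilvermanAEC2009] III.§1.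
-/

set_option autoImplicit false
-- the Theorems namespace of this sub repeats the summit name by design (D-0017 nested layout)
set_option linter.dupNamespace false

noncomputable section

open scoped Classical Polynomial

open CongruenceSubgroup WeierstrassCurve Literature.NumberTheory.EllipticCurves
  Literature.NumberTheory.EllipticCurves.ModularForms Summit.BirchSwinnertonDyer.Rank1Residual.X1.MuLambda
  Literature.NumberTheory.EllipticCurves.Rank1Residual Literature.NumberTheory.EllipticCurves.Rank1Residual.Typed
  Literature.NumberTheory.EllipticCurves.Kobayashi2003 Literature.NumberTheory.EllipticCurves.IwasawaDual
  Literature.NumberTheory.IwasawaTheory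
  ZpExtension Summit.BirchSwinnertonDyer.Rank1Residual Summit.BirchSwinnertonDyer.Rank1Residual.Supersingular
  Summit.BirchSwinnertonDyer.Rank1Residual.X5 Summit.BirchSwinnertonDyer.Rank1Residual.X5.O1

namespace Summit.BirchSwinnertonDyer.BirchSwinnertonDyer.Theorems
namespace SSUnitAnchor

section Door

variable (ME MA : WeierstrassCurve ℤ)
  [(ME.baseChange ℚ).IsElliptic] [(ME.baseChange ℚ).IsGloballyMinimal]
  [(MA.baseChange ℚ).IsElliptic] [(MA.baseChange ℚ).IsGloballyMinimal]

/-- **THE UNIT-ANCHOR KIT DOOR, `Λ`-form, Mazur–Tate keyed, `μ`-TRANSPORT IN THE KERNEL for `Δ_E < 0`** — GEN 5's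
`kobayashiMainConjecture_two_baseChange_int_of_unitAnchor_of_mazurTate` (p577225) VERBATIM except that the pair binder formerly called the
`μ`-transport («`X⁺(E)`, `X⁺(A)` torsion, `μ⁺(A) = 0 ⇒ μ⁺(E) = 0`», B. D. Kim 2009 Cor. 2.13 `μ`-half READ AT `2`) is REPLACED by the
hypothesis `Δ(M_E) < 0`: the CM-free kernel transport `SignedTransportAtTwo.TwoCongruence.muTransport_two_of_twoCongruence_negDisc` supplies it.
Displayed: PUB (`hmod`, `hGZK`, `h124`, `hX0`, `h2`); AT `E`: (2′) `hEC`, (4)ʳᵃᵗ `hCK`; AT the anchor `A`: (2′) `hECA`, CERT `hLA`/`hTam`/`hSha`;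
AT THE PAIR: `hlamT` (census numeral `ℓ*`); CERT: the layer certificate `hMT`. Closes nothing; BSD is not proved by any of this.
[cite: BDKim2009, Cor. 2.13] [cite: Kobayashi2003, Thm. 1.2 and Thm. 4.1] [cite: Kato2004Asterisque, Thm. 12.4–12.5 (3)] [cite: BDKim2013, Cor. 3.15]
[cite: Pollack2003, Prop. 6.18] [cite: AbbesUllmo1996, Thm. A] [cite: SilvermanAEC2009, III.§1] [cite: Miller2011LMS, Def. 1.1] -/
theorem kobayashiMainConjecture_two_baseChange_int_of_unitAnchor_of_mazurTate_negDisc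
    (hmod : nonempty_modularParametrizationData) (hGZK : rank_eq_analyticRank_of_analyticRank_le_one)
    (h124 : Kato2004.thm12_4) (hX0 : Kato2004_fineSelmerDual_isTorsion)
    (hL : (ME.baseChange ℚ).entireLFunction 1 ≠ 0)
    (hss : GoodSS (ME.baseChange ℚ) 2) (ha : (ME.baseChange ℚ).frobeniusTrace 2 = 0)
    (hLA : (MA.baseChange ℚ).entireLFunction 1 ≠ 0)
    (hAss : GoodSS (MA.baseChange ℚ) 2) (hAa : (MA.baseChange ℚ).frobeniusTrace 2 = 0)
    (hTam : ¬ 2 ∣ (MA.baseChange ℚ).tamagawaProduct) (hSha : ¬ 2 ∣ (MA.baseChange ℚ).shaOrder)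
    (q r : ℚ[X])
    (hroot : ∀ ξ : AlgebraicClosure ℚ, Polynomial.aeval ξ (ME.baseChange ℚ).twoTorsionPolynomial.toPoly = 0 →
      Polynomial.aeval (Polynomial.aeval ξ q) (MA.baseChange ℚ).twoTorsionPolynomial.toPoly = 0)
    (hinv : ∀ ξ : AlgebraicClosure ℚ, Polynomial.aeval ξ (ME.baseChange ℚ).twoTorsionPolynomial.toPoly = 0 →
      Polynomial.aeval (Polynomial.aeval ξ q) r = ξ)
    (hEC : ∀ (κ : ZpExtension ℚ 2) (γ : Field.absoluteGaloisGroup ℚ),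
          κ.IsCyclotomic → κ.IsTopGenerator γ → Finite ((ME.baseChange ℚ).selmerGroupPInfty 2) →
          Finite (endInvariants (conjSignedSelmerInfty (ME.baseChange ℚ) κ 1 γ - 1)) ∧
            ∃ u : ℤ_[2]ˣ, (Nat.card (endInvariants (conjSignedSelmerInfty (ME.baseChange ℚ) κ 1 γ - 1)) : ℚ_[2]) =
              ((u : ℤ_[2]) : ℚ_[2]) * ((2 : ℕ) : ℚ_[2]) ^ (padicValNat 2 (ME.baseChange ℚ).tamagawaProduct) *
                (Nat.card ((ME.baseChange ℚ).selmerGroupPInfty 2) : ℚ_[2]) *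
                  (Nat.card (EndCoinvariants (conjSignedSelmerInfty (ME.baseChange ℚ) κ 1 γ - 1)) : ℚ_[2]))
    (hCK : ∀ (κ : ZpExtension ℚ 2) (γ : Field.absoluteGaloisGroup ℚ),
        κ.IsCyclotomic → κ.IsTopGenerator γ → IsCyclotomicVariable 2 γ →
        ∀ [NeZero ((ME.baseChange ℚ).conductorNorm ℤ)] (f : CuspForm (Gamma0 ((ME.baseChange ℚ).conductorNorm ℤ)) 2),
          IsNewformOf (ME.baseChange ℚ) f → ∀ (ϖ : ℚ), (ϖ : ℝ) * (ME.baseChange ℚ).realPeriodRat = plusPeriod f →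
        ∀ (Lplus Lminus : IwasawaAlgebra 2), IsPollackPair f 2 Lplus Lminus →
        ∀ (D : SignedSelmerDualData (ME.baseChange ℚ) κ γ 1) [ContinuousSMul ℤ_[2] ((ME.baseChange ℚ).tateModule 2)],
          ∃ (I : Kato2004.IwasawaH1Data (ME.baseChange ℚ) 2 κ γ) (Y : (ME.baseChange ℚ).FineSelmerDualData κ γ)
            (P : Submodule (IwasawaAlgebra 2) (IwasawaAlgebra 2))
            (loc : I.H →ₗ[IwasawaAlgebra 2] P) (toX : P →ₗ[IwasawaAlgebra 2] D.X)
            (δ : D.X →ₗ[IwasawaAlgebra 2] Y.X) (Z : Submodule (IwasawaAlgebra 2) I.H)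
            (G : IwasawaAlgebra 2),
            Function.Exact loc toX ∧ Function.Exact toX δ ∧
            G ∈ Submodule.map (P.subtype ∘ₗ loc) Z ∧
            iwasawaToPowerSeries 2 G =
              PowerSeries.C (ϖ : ℚ_[2]) * iwasawaToPowerSeries 2 (kobayashiL 1 Lplus Lminus) ∧
            (∀ 𝔭 : PrimeSpectrum (IwasawaAlgebra 2), 𝔭.asIdeal.height = 1 →
              PowerSeries.C (2 : ℤ_[2]) ∉ 𝔭.asIdeal →
              Literature.NumberTheory.EllipticCurves.Module.lengthAt (IwasawaAlgebra 2) Y.X 𝔭 ≤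
                Literature.NumberTheory.EllipticCurves.Module.lengthAt (IwasawaAlgebra 2) (I.H ⧸ Z) 𝔭))
    (hECA : ∀ (κ : ZpExtension ℚ 2) (γ : Field.absoluteGaloisGroup ℚ),
          κ.IsCyclotomic → κ.IsTopGenerator γ → Finite ((MA.baseChange ℚ).selmerGroupPInfty 2) →
          Finite (endInvariants (conjSignedSelmerInfty (MA.baseChange ℚ) κ 1 γ - 1)) ∧
            ∃ u : ℤ_[2]ˣ, (Nat.card (endInvariants (conjSignedSelmerInfty (MA.baseChange ℚ) κ 1 γ - 1)) : ℚ_[2]) =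
              ((u : ℤ_[2]) : ℚ_[2]) * ((2 : ℕ) : ℚ_[2]) ^ (padicValNat 2 (MA.baseChange ℚ).tamagawaProduct) *
                (Nat.card ((MA.baseChange ℚ).selmerGroupPInfty 2) : ℚ_[2]) *
                  (Nat.card (EndCoinvariants (conjSignedSelmerInfty (MA.baseChange ℚ) κ 1 γ - 1)) : ℚ_[2]))
    (hΔ : ME.Δ < 0)
    (ℓ : ℕ)
    (hlamT : GoodSS (ME.baseChange ℚ) 2 → (ME.baseChange ℚ).frobeniusTrace 2 = 0 →
      GoodSS (MA.baseChange ℚ) 2 → (MA.baseChange ℚ).frobeniusTrace 2 = 0 →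
      (∃ e : WeierstrassCurve.geomTorsion (ME.baseChange ℚ) (2 : ℤ) ≃+ WeierstrassCurve.geomTorsion (MA.baseChange ℚ) (2 : ℤ),
        ∀ (σ : Field.absoluteGaloisGroup ℚ) (P : WeierstrassCurve.geomTorsion (ME.baseChange ℚ) (2 : ℤ)),
          e (σ • P) = σ • e P) →
      ∀ (κ : ZpExtension ℚ 2) (γ : Field.absoluteGaloisGroup ℚ), κ.IsCyclotomic → κ.IsTopGenerator γ →
      ∀ (D : SignedSelmerDualData (ME.baseChange ℚ) κ γ 1) (D' : SignedSelmerDualData (MA.baseChange ℚ) κ γ 1)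
        [Module.Finite (IwasawaAlgebra 2) D.X] [Module.Finite (IwasawaAlgebra 2) D'.X],
        Module.IsTorsion (IwasawaAlgebra 2) D.X → Module.IsTorsion (IwasawaAlgebra 2) D'.X →
        D.mu = 0 → D'.mu = 0 → lambdaInvariant 2 D.X = lambdaInvariant 2 D'.X + ℓ)
    (h2 : realPeriodRat_eq_unit_mul_plusPeriod_two) {n : ℕ} (hn : Even n)
    (hMT : ∀ [NeZero ((ME.baseChange ℚ).conductorNorm ℤ)] (f : CuspForm (Gamma0 ((ME.baseChange ℚ).conductorNorm ℤ)) 2),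
        IsNewformOf (ME.baseChange ℚ) f →
      ((mazurTateElement f 2 n).map (algebraMap ℚ (PadicAlgCl 2))).supNorm = 1 ∧
        layerLambda ((mazurTateElement f 2 n).map (algebraMap ℚ (PadicAlgCl 2))) = (2 ^ n - 1) / 3 + ℓ) :
    KobayashiMainConjecture (ME.baseChange ℚ) 2 1 := by
  obtain ⟨e, he⟩ := ThetaPartnerXRoute.exists_equivariant_addEquiv_geomTorsion_two_of_tschirnhaus (K := ℚ)
    two_ne_zero (ME.baseChange ℚ) (MA.baseChange ℚ) q r hroot hinv
  exact SSMazurTate.kobayashiMainConjecture_two_of_unitAnchor_of_mazurTate (ME.baseChange ℚ) (MA.baseChange ℚ) hmod hGZK h124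
    hX0 h2 (analyticRank_eq_zero_of_entireLFunction_one_ne_zero _ hL) hss ha
    (analyticRank_eq_zero_of_entireLFunction_one_ne_zero _ hLA) hAss hAa hTam hSha e he hEC hCK hECA
    (SignedTransportAtTwo.TwoCongruence.muTransport_two_of_twoCongruence_negDisc (ME.baseChange ℚ)
      (by rw [baseChange_int_Δ]; exact_mod_cast hΔ) (MA.baseChange ℚ)) ℓ hlamT hn hMT



/-- **`BSDp (M_E ⊗ ℚ) 2` on the unit-anchor road, `Λ`-form, Mazur–Tate keyed, `μ`-transport in the kernel for `Δ_E < 0`** — GEN 5's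
`bsdp_two_baseChange_int_of_unitAnchor_of_mazurTate` with the `μ`-transport binder replaced by `Δ(M_E) < 0` (see the companion door).
Closes nothing; BSD is not proved by any of this. [cite: BDKim2009, Cor. 2.13] [cite: Kobayashi2003, Thm. 1.2 and Thm. 4.1]
[cite: Kato2004Asterisque, Thm. 12.4–12.5 (3)] [cite: BDKim2013, Cor. 3.15] [cite: Pollack2003, Prop. 6.18] [cite: AbbesUllmo1996, Thm. A]
[cite: Miller2011LMS, Def. 1.1] -/
theorem bsdp_two_baseChange_int_of_unitAnchor_of_mazurTate_negDisc
    (hmod : nonempty_modularParametrizationData) (hGZK : rank_eq_analyticRank_of_analyticRank_le_one)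
    (h124 : Kato2004.thm12_4) (hX0 : Kato2004_fineSelmerDual_isTorsion)
    (hL : (ME.baseChange ℚ).entireLFunction 1 ≠ 0)
    (hss : GoodSS (ME.baseChange ℚ) 2) (ha : (ME.baseChange ℚ).frobeniusTrace 2 = 0)
    (hLA : (MA.baseChange ℚ).entireLFunction 1 ≠ 0)
    (hAss : GoodSS (MA.baseChange ℚ) 2) (hAa : (MA.baseChange ℚ).frobeniusTrace 2 = 0)
    (hTam : ¬ 2 ∣ (MA.baseChange ℚ).tamagawaProduct) (hSha : ¬ 2 ∣ (MA.baseChange ℚ).shaOrder)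
    (q r : ℚ[X])
    (hroot : ∀ ξ : AlgebraicClosure ℚ, Polynomial.aeval ξ (ME.baseChange ℚ).twoTorsionPolynomial.toPoly = 0 →
      Polynomial.aeval (Polynomial.aeval ξ q) (MA.baseChange ℚ).twoTorsionPolynomial.toPoly = 0)
    (hinv : ∀ ξ : AlgebraicClosure ℚ, Polynomial.aeval ξ (ME.baseChange ℚ).twoTorsionPolynomial.toPoly = 0 →
      Polynomial.aeval (Polynomial.aeval ξ q) r = ξ)
    (hEC : ∀ (κ : ZpExtension ℚ 2) (γ : Field.absoluteGaloisGroup ℚ),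
          κ.IsCyclotomic → κ.IsTopGenerator γ → Finite ((ME.baseChange ℚ).selmerGroupPInfty 2) →
          Finite (endInvariants (conjSignedSelmerInfty (ME.baseChange ℚ) κ 1 γ - 1)) ∧
            ∃ u : ℤ_[2]ˣ, (Nat.card (endInvariants (conjSignedSelmerInfty (ME.baseChange ℚ) κ 1 γ - 1)) : ℚ_[2]) =
              ((u : ℤ_[2]) : ℚ_[2]) * ((2 : ℕ) : ℚ_[2]) ^ (padicValNat 2 (ME.baseChange ℚ).tamagawaProduct) *
                (Nat.card ((ME.baseChange ℚ).selmerGroupPInfty 2) : ℚ_[2]) *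
                  (Nat.card (EndCoinvariants (conjSignedSelmerInfty (ME.baseChange ℚ) κ 1 γ - 1)) : ℚ_[2]))
    (hCK : ∀ (κ : ZpExtension ℚ 2) (γ : Field.absoluteGaloisGroup ℚ),
        κ.IsCyclotomic → κ.IsTopGenerator γ → IsCyclotomicVariable 2 γ →
        ∀ [NeZero ((ME.baseChange ℚ).conductorNorm ℤ)] (f : CuspForm (Gamma0 ((ME.baseChange ℚ).conductorNorm ℤ)) 2),
          IsNewformOf (ME.baseChange ℚ) f → ∀ (ϖ : ℚ), (ϖ : ℝ) * (ME.baseChange ℚ).realPeriodRat = plusPeriod f →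
        ∀ (Lplus Lminus : IwasawaAlgebra 2), IsPollackPair f 2 Lplus Lminus →
        ∀ (D : SignedSelmerDualData (ME.baseChange ℚ) κ γ 1) [ContinuousSMul ℤ_[2] ((ME.baseChange ℚ).tateModule 2)],
          ∃ (I : Kato2004.IwasawaH1Data (ME.baseChange ℚ) 2 κ γ) (Y : (ME.baseChange ℚ).FineSelmerDualData κ γ)
            (P : Submodule (IwasawaAlgebra 2) (IwasawaAlgebra 2))
            (loc : I.H →ₗ[IwasawaAlgebra 2] P) (toX : P →ₗ[IwasawaAlgebra 2] D.X)
            (δ : D.X →ₗ[IwasawaAlgebra 2] Y.X) (Z : Submodule (IwasawaAlgebra 2) I.H)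
            (G : IwasawaAlgebra 2),
            Function.Exact loc toX ∧ Function.Exact toX δ ∧
            G ∈ Submodule.map (P.subtype ∘ₗ loc) Z ∧
            iwasawaToPowerSeries 2 G =
              PowerSeries.C (ϖ : ℚ_[2]) * iwasawaToPowerSeries 2 (kobayashiL 1 Lplus Lminus) ∧
            (∀ 𝔭 : PrimeSpectrum (IwasawaAlgebra 2), 𝔭.asIdeal.height = 1 →
              PowerSeries.C (2 : ℤ_[2]) ∉ 𝔭.asIdeal →
              Literature.NumberTheory.EllipticCurves.Module.lengthAt (IwasawaAlgebra 2) Y.X 𝔭 ≤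
                Literature.NumberTheory.EllipticCurves.Module.lengthAt (IwasawaAlgebra 2) (I.H ⧸ Z) 𝔭))
    (hECA : ∀ (κ : ZpExtension ℚ 2) (γ : Field.absoluteGaloisGroup ℚ),
          κ.IsCyclotomic → κ.IsTopGenerator γ → Finite ((MA.baseChange ℚ).selmerGroupPInfty 2) →
          Finite (endInvariants (conjSignedSelmerInfty (MA.baseChange ℚ) κ 1 γ - 1)) ∧
            ∃ u : ℤ_[2]ˣ, (Nat.card (endInvariants (conjSignedSelmerInfty (MA.baseChange ℚ) κ 1 γ - 1)) : ℚ_[2]) =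
              ((u : ℤ_[2]) : ℚ_[2]) * ((2 : ℕ) : ℚ_[2]) ^ (padicValNat 2 (MA.baseChange ℚ).tamagawaProduct) *
                (Nat.card ((MA.baseChange ℚ).selmerGroupPInfty 2) : ℚ_[2]) *
                  (Nat.card (EndCoinvariants (conjSignedSelmerInfty (MA.baseChange ℚ) κ 1 γ - 1)) : ℚ_[2]))
    (hΔ : ME.Δ < 0)
    (ℓ : ℕ)
    (hlamT : GoodSS (ME.baseChange ℚ) 2 → (ME.baseChange ℚ).frobeniusTrace 2 = 0 →
      GoodSS (MA.baseChange ℚ) 2 → (MA.baseChange ℚ).frobeniusTrace 2 = 0 →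
      (∃ e : WeierstrassCurve.geomTorsion (ME.baseChange ℚ) (2 : ℤ) ≃+ WeierstrassCurve.geomTorsion (MA.baseChange ℚ) (2 : ℤ),
        ∀ (σ : Field.absoluteGaloisGroup ℚ) (P : WeierstrassCurve.geomTorsion (ME.baseChange ℚ) (2 : ℤ)),
          e (σ • P) = σ • e P) →
      ∀ (κ : ZpExtension ℚ 2) (γ : Field.absoluteGaloisGroup ℚ), κ.IsCyclotomic → κ.IsTopGenerator γ →
      ∀ (D : SignedSelmerDualData (ME.baseChange ℚ) κ γ 1) (D' : SignedSelmerDualData (MA.baseChange ℚ) κ γ 1)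
        [Module.Finite (IwasawaAlgebra 2) D.X] [Module.Finite (IwasawaAlgebra 2) D'.X],
        Module.IsTorsion (IwasawaAlgebra 2) D.X → Module.IsTorsion (IwasawaAlgebra 2) D'.X →
        D.mu = 0 → D'.mu = 0 → lambdaInvariant 2 D.X = lambdaInvariant 2 D'.X + ℓ)
    (h2 : realPeriodRat_eq_unit_mul_plusPeriod_two) {n : ℕ} (hn : Even n)
    (hMT : ∀ [NeZero ((ME.baseChange ℚ).conductorNorm ℤ)] (f : CuspForm (Gamma0 ((ME.baseChange ℚ).conductorNorm ℤ)) 2),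
        IsNewformOf (ME.baseChange ℚ) f →
      ((mazurTateElement f 2 n).map (algebraMap ℚ (PadicAlgCl 2))).supNorm = 1 ∧
        layerLambda ((mazurTateElement f 2 n).map (algebraMap ℚ (PadicAlgCl 2))) = (2 ^ n - 1) / 3 + ℓ) :
    BSDp (ME.baseChange ℚ) 2 := by
  obtain ⟨e, he⟩ := ThetaPartnerXRoute.exists_equivariant_addEquiv_geomTorsion_two_of_tschirnhaus (K := ℚ)
    two_ne_zero (ME.baseChange ℚ) (MA.baseChange ℚ) q r hroot hinv
  exact SSMazurTate.bsdp_two_of_unitAnchor_of_mazurTate (ME.baseChange ℚ) (MA.baseChange ℚ) hmod hGZK h124 hX0 h2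
    (analyticRank_eq_zero_of_entireLFunction_one_ne_zero _ hL) hss ha
    (analyticRank_eq_zero_of_entireLFunction_one_ne_zero _ hLA) hAss hAa hTam hSha e he hEC hCK hECA
    (SignedTransportAtTwo.TwoCongruence.muTransport_two_of_twoCongruence_negDisc (ME.baseChange ℚ)
      (by rw [baseChange_int_Δ]; exact_mod_cast hΔ) (MA.baseChange ℚ)) ℓ hlamT hn hMT


end Door

end SSUnitAnchor
end Summit.BirchSwinnertonDyer.BirchSwinnertonDyer.Theorems

end
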